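import Summits.QuantumFields.YangMills.Theorems.LuscherReductionTwistedTraceScalingSliceTaylorBased
import Summits.QuantumFields.YangMills.Theorems.LuscherReductionTwistedTraceScalingBasedNearOne
import Summits.QuantumFields.YangMills.Theorems.LuscherReductionTwistedTraceScalingGaugeGroupGaussianSandwich
import HarnessLib

/-!
# Chart bookkeeping for the based Faddeev–Popov integrand: gnomonic flat coordinates ↔ based gauge parameters, cubic closeness, support localisation
# (lane A of S-BASE, crux `TwistedTraceScaling` stmt-QuantumFields-20203, C4 INNER; design note `pub/ym-fleet/ym-luscher-20007-p1/COARSE-DESIGN.md` §23.9 (N2))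

`N(U) = ∫_{based h} recordWeightRho(U^{basedExt h}) dh` (`…RecordWeightRho`), and `…GaugeGroupGnChart` writes based Haar integrals in the flat coordinates
`w : NzSite L → Fin 3 → ℝ`, `h_y = gnoPoint (w y)`.  The Laplace data (`…SliceTaylorBased`, `…SliceCoerciveBased`) speak of based gauge PARAMETERS `ξ` with `h_x = P(ξ_x)`
(`P = chartSU2`, orthographic).  THIS FILE links the two:
* `flatLin` — the linear isomorphism `w ↦ ξ` (extension by `0` at the origin) onto `basedSubmodule`, norm preserving (`norm_flatLin`);
* `gnoParam w` — the based parameter of `basedExt (gnoPoint ∘ w)`: `ξ_x = vecPart(gnoPoint w_x) = w_x/√(1+|w_x|²)`; ★ `basedExt_gno_eq`: `basedExt (gnoPoint ∘ w) = P ∘ gnoParam w`;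
* `norm_gnoParam_le` (`‖gnoParam w‖ ≤ ‖w‖`) and ★ `norm_gnoParam_sub_flatLin_le` (`‖gnoParam w − flatLin w‖ ≤ 2‖w‖³`: gnomonic vs orthographic is a CUBIC correction);
* ★ `norm_le_of_gno_nearOne` — support localisation in flat coordinates: `U ∈ nearOne r₁`, `U^{basedExt(gno∘w)} ∈ nearOne r₂`, `3(L−1)(r₁+r₂) ≤ 1` ⇒ `‖w‖∞ ≤ 3(L−1)(r₁+r₂)`.
HONEST FRAMING: bookkeeping for a stub of a child of the CONDITIONAL reduction route R2b1; no spectral claim; C4 OPEN; not a gap, not Clay.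
-/

set_option autoImplicit false

noncomputable section

open Real
open scoped BigOperators
open Literature.MathematicalPhysics.QuantumFieldTheory
open Literature.MathematicalPhysics.QuantumLattice

namespace Summit.QuantumFields.YangMills.Theorems.FemtoTransferGap.TwoLattice.ConstTube

open Summit.QuantumFields.YangMills.Theorems.FemtoTransferGap
open Literature.MathematicalPhysics.QuantumFieldTheory.Balaban1983to89.T4CubeChartGnomonic (gnoPoint)
open Literature.Algebra.EuclideanLattices (abs_apply_le_norm)

variable (L : ℕ) [NeZero L]

/-! ## §1 Flat coordinates ↔ based parameters -/

/-- Extension by zero at the origin: flat coordinates `w : NzSite → ℝ³` ↦ based gauge parameter. [folklore] -/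
def flatLin : (NzSite L → Fin 3 → ℝ) →ₗ[ℝ] basedSubmodule L where
  toFun w := ⟨fun x => if hx : x = 0 then 0 else w ⟨x, hx⟩, by simp [basedSubmodule]⟩
  map_add' a b := by
    apply Subtype.ext; funext x
    by_cases hx : x = 0
    · simp [hx]
    · simp [hx]
  map_smul' r a := by
    apply Subtype.ext; funext x
    by_cases hx : x = 0
    · simp [hx]
    · simp [hx]

omit [NeZero L] in
/-- Values off the origin. [folklore] -/
theorem flatLin_apply_of_ne (w : NzSite L → Fin 3 → ℝ) {x : Site 3 L} (hx : ¬x = 0) : (flatLin L w : Site 3 L → Fin 3 → ℝ) x = w ⟨x, hx⟩ := by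
  simp [flatLin, hx]

omit [NeZero L] in
/-- Value at the origin. [folklore] -/
@[simp] theorem flatLin_apply_zero (w : NzSite L → Fin 3 → ℝ) : (flatLin L w : Site 3 L → Fin 3 → ℝ) 0 = 0 := by simp [flatLin]

/-- `flatLin` preserves the sup norm. [folklore] -/
theorem norm_flatLin (w : NzSite L → Fin 3 → ℝ) : ‖flatLin L w‖ = ‖w‖ := by
  rw [Submodule.coe_norm]
  apply le_antisymm
  · refine (pi_norm_le_iff_of_nonneg (norm_nonneg _)).mpr fun x => ?_
    by_cases hx : x = 0
    · subst hx; rw [flatLin_apply_zero, norm_zero]; exact norm_nonneg _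
    · rw [flatLin_apply_of_ne L w hx]; exact norm_le_pi_norm w ⟨x, hx⟩
  · refine (pi_norm_le_iff_of_nonneg (norm_nonneg _)).mpr fun y => ?_
    have h := norm_le_pi_norm (flatLin L w : Site 3 L → Fin 3 → ℝ) y.1
    rwa [flatLin_apply_of_ne L w y.2] at h

omit [NeZero L] in
/-- `flatLin` is injective. [folklore] -/
theorem flatLin_injective : Function.Injective (flatLin L) := fun a b h => by
  funext y
  have := congrArg (fun ξ : basedSubmodule L => (ξ : Site 3 L → Fin 3 → ℝ) y.1) h
  simpa [flatLin_apply_of_ne L _ y.2] using this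

omit [NeZero L] in
/-- `flatLin` is surjective. [folklore] -/
theorem flatLin_surjective : Function.Surjective (flatLin L) := fun ξ => by
  refine ⟨fun y => (ξ : Site 3 L → Fin 3 → ℝ) y.1, Subtype.ext (funext fun x => ?_)⟩
  by_cases hx : x = 0
  · subst hx; rw [flatLin_apply_zero]; exact (show (ξ : Site 3 L → Fin 3 → ℝ) 0 = 0 from ξ.2).symm
  · rw [flatLin_apply_of_ne L _ hx]

/-- The based parameter of `basedExt (gnoPoint ∘ w)`: `ξ_x = vecPart (gnoPoint w_x)` off the origin. [folklore] -/
def gnoParam (w : NzSite L → Fin 3 → ℝ) : basedSubmodule L := flatLin L fun y => vecPart (gnoPoint (w y))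

omit [NeZero L] in
/-- ★ `basedExt (gnoPoint ∘ w) = P ∘ gnoParam w`. [folklore] -/
theorem basedExt_gno_eq (w : NzSite L → Fin 3 → ℝ) :
    basedExt L (fun y => gnoPoint (w y)) = fun x => chartSU2 ((gnoParam L w : Site 3 L → Fin 3 → ℝ) x) := by
  funext x
  by_cases hx : x = 0
  · subst hx
    rw [basedExt_zero]
    show (1 : SU2) = chartSU2 ((flatLin L fun y => vecPart (gnoPoint (w y)) : Site 3 L → Fin 3 → ℝ) 0)
    rw [flatLin_apply_zero, chartSU2_zero']
  · rw [basedExt_of_ne L _ hx]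
    show gnoPoint (w ⟨x, hx⟩) = chartSU2 ((flatLin L fun y => vecPart (gnoPoint (w y)) : Site 3 L → Fin 3 → ℝ) x)
    rw [flatLin_apply_of_ne L _ hx, chartSU2_vecPart _ (scalarPart_gnoPoint_pos _).le]

omit [NeZero L] in
/-- `|vecPart (gnoPoint v)_a| ≤ |v_a|`. [folklore] -/
theorem abs_vecPart_gnoPoint_le (v : Fin 3 → ℝ) (a : Fin 3) : |vecPart (gnoPoint v) a| ≤ |v a| := by
  rw [vecPart_gnoPoint, abs_mul, abs_inv, abs_of_pos (norm_gnomonicQuat_pos v)]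
  have h1 : 1 ≤ ‖gnomonicQuat v‖ := by
    have h := sq_norm_gnomonicQuat v
    have hs : 0 ≤ ∑ i, v i ^ 2 := Finset.sum_nonneg fun i _ => sq_nonneg _
    nlinarith [norm_nonneg (gnomonicQuat v)]
  calc ‖gnomonicQuat v‖⁻¹ * |v a| ≤ 1 * |v a| := mul_le_mul_of_nonneg_right (inv_le_one_of_one_le₀ h1) (abs_nonneg _)
    _ = |v a| := one_mul _

omit [NeZero L] in
/-- `‖vecPart (gnoPoint v)‖∞ ≤ ‖v‖∞`. [folklore] -/
theorem norm_vecPart_gnoPoint_le (v : Fin 3 → ℝ) : ‖vecPart (gnoPoint v)‖ ≤ ‖v‖ :=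
  (pi_norm_le_iff_of_nonneg (norm_nonneg _)).mpr fun a => by
    rw [Real.norm_eq_abs]; exact (abs_vecPart_gnoPoint_le v a).trans (abs_apply_le_norm v a)

/-- `‖gnoParam w‖ ≤ ‖w‖`. [folklore] -/
theorem norm_gnoParam_le (w : NzSite L → Fin 3 → ℝ) : ‖gnoParam L w‖ ≤ ‖w‖ := by
  rw [gnoParam, norm_flatLin]
  exact (pi_norm_le_iff_of_nonneg (norm_nonneg _)).mpr fun y => (norm_vecPart_gnoPoint_le (w y)).trans (norm_le_pi_norm w y)

omit [NeZero L] in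
/-- The gnomonic/orthographic discrepancy is cubic: `|vecPart (gnoPoint v)_a − v_a| ≤ 2‖v‖∞³`. [folklore] -/
theorem abs_vecPart_gnoPoint_sub_le (v : Fin 3 → ℝ) (a : Fin 3) : |vecPart (gnoPoint v) a - v a| ≤ 2 * ‖v‖ ^ 3 := by
  set q : ℝ := ‖gnomonicQuat v‖ with hq
  have hq0 : 0 < q := norm_gnomonicQuat_pos v
  have hqs : q ^ 2 = 1 + ∑ i, v i ^ 2 := sq_norm_gnomonicQuat v
  have hs0 : 0 ≤ ∑ i, v i ^ 2 := Finset.sum_nonneg fun i _ => sq_nonneg _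
  have hq1 : 1 ≤ q := by nlinarith
  have h3 := sum_sq_le_three_norm_sq v
  -- `1 − 1/q = (q − 1)/q ≤ q − 1 ≤ (q² − 1)/2 = Σv²/2 ≤ (3/2)‖v‖²`
  have hform : vecPart (gnoPoint v) a - v a = -(1 - q⁻¹) * v a := by rw [vecPart_gnoPoint]; ring
  rw [hform, abs_mul, abs_neg, abs_of_nonneg (by rw [sub_nonneg]; exact inv_le_one_of_one_le₀ hq1)]
  have h1 : 1 - q⁻¹ ≤ q - 1 := by
    rw [show 1 - q⁻¹ = (q - 1) / q by field_simp]
    exact div_le_self (by linarith) hq1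
  have h2 : q - 1 ≤ (∑ i, v i ^ 2) / 2 := by nlinarith
  have h4 : 1 - q⁻¹ ≤ 3 / 2 * ‖v‖ ^ 2 := by linarith
  calc (1 - q⁻¹) * |v a| ≤ (3 / 2 * ‖v‖ ^ 2) * ‖v‖ :=
        mul_le_mul h4 (abs_apply_le_norm v a) (abs_nonneg _) (by positivity)
    _ ≤ 2 * ‖v‖ ^ 3 := by nlinarith [norm_nonneg v]

/-- ★ `‖gnoParam w − flatLin w‖ ≤ 2‖w‖³`. [folklore] -/
theorem norm_gnoParam_sub_flatLin_le (w : NzSite L → Fin 3 → ℝ) : ‖gnoParam L w - flatLin L w‖ ≤ 2 * ‖w‖ ^ 3 := by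
  rw [gnoParam, ← map_sub, norm_flatLin]
  refine (pi_norm_le_iff_of_nonneg (by positivity)).mpr fun y => ?_
  refine (pi_norm_le_iff_of_nonneg (by positivity)).mpr fun a => ?_
  rw [Pi.sub_apply, Pi.sub_apply, Real.norm_eq_abs]
  calc |vecPart (gnoPoint (w y)) a - w y a| ≤ 2 * ‖w y‖ ^ 3 := abs_vecPart_gnoPoint_sub_le (w y) a
    _ ≤ 2 * ‖w‖ ^ 3 := by gcongr; exact norm_le_pi_norm w y

/-! ## §2 Support localisation in flat coordinates -/

omit [NeZero L] in
/-- If `‖gnoPoint v − 1‖_F ≤ R ≤ 1` then `‖v‖∞ ≤ R`. [folklore] -/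
theorem norm_le_of_frobNorm_gnoPoint_le {v : Fin 3 → ℝ} {R : ℝ} (hR1 : R ≤ 1) (h : frobNorm (((gnoPoint v : SU2) : Matrix (Fin 2) (Fin 2) ℂ) - 1) ≤ R) :
    ‖v‖ ≤ R := by
  set q : ℝ := ‖gnomonicQuat v‖ with hq
  set t : ℝ := ∑ i, v i ^ 2 with ht
  have hq0 : 0 < q := norm_gnomonicQuat_pos v
  have hqs : q ^ 2 = 1 + t := sq_norm_gnomonicQuat v
  have ht0 : 0 ≤ t := Finset.sum_nonneg fun i _ => sq_nonneg _
  have hR0 : 0 ≤ R := (frobNorm_nonneg _).trans h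
  have hF : frobNorm (((gnoPoint v : SU2) : Matrix (Fin 2) (Fin 2) ℂ) - 1) ^ 2 = 4 * (1 - q⁻¹) := by
    rw [frobNorm_sub_one_sq_eq_scalarPart, scalarPart_gnoPoint]
  have hF2 : 4 * (1 - q⁻¹) ≤ R ^ 2 := by rw [← hF]; exact pow_le_pow_left₀ (frobNorm_nonneg _) h 2
  have hR2 : R ^ 2 ≤ 1 := by nlinarith
  -- `q ≤ 4/3`
  have hinv : 3 / 4 ≤ q⁻¹ := by linarith
  have hq43 : q ≤ 4 / 3 := by
    have h1 := mul_le_mul_of_nonneg_left hinv hq0.le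
    rw [mul_inv_cancel₀ hq0.ne'] at h1
    linarith
  -- `t = (1 − 1/q)·q(q+1) ≤ (R²/4)·(28/9) ≤ R²`
  have hteq : t = (1 - q⁻¹) * (q * (q + 1)) := by
    have : (1 - q⁻¹) * (q * (q + 1)) = (q - 1) * (q + 1) := by field_simp
    rw [this]; nlinarith
  have hqq : q * (q + 1) ≤ 28 / 9 := by nlinarith
  have hone : 0 ≤ 1 - q⁻¹ := by
    rw [sub_nonneg]; exact inv_le_one_of_one_le₀ (by nlinarith)
  have ht1 : t ≤ R ^ 2 := by
    calc t = (1 - q⁻¹) * (q * (q + 1)) := hteq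
      _ ≤ (R ^ 2 / 4) * (28 / 9) := mul_le_mul (by linarith) hqq (by positivity) (by positivity)
      _ ≤ R ^ 2 := by nlinarith
  refine (pi_norm_le_iff_of_nonneg hR0).mpr fun a => ?_
  rw [Real.norm_eq_abs]
  have hva : v a ^ 2 ≤ R ^ 2 := (Finset.single_le_sum (fun i _ => sq_nonneg (v i)) (Finset.mem_univ a)).trans ht1
  have hh := abs_le_of_sq_le_sq' hva hR0
  exact abs_le.mpr ⟨hh.1, hh.2⟩

/-- ★ **Support localisation in flat coordinates**: `U ∈ nearOne r₁`, `U^{basedExt(gno∘w)} ∈ nearOne r₂`, `3(L−1)(r₁+r₂) ≤ 1` ⇒ `‖w‖∞ ≤ 3(L−1)(r₁+r₂)`. [folklore] -/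
theorem norm_le_of_gno_nearOne {w : NzSite L → Fin 3 → ℝ} {U : GaugeConfig 3 L SU2} {r₁ r₂ : ℝ} (hU : U ∈ nearOne L r₁)
    (hUh : gaugeTransform (basedExt L fun y => gnoPoint (w y)) U ∈ nearOne L r₂) (hsmall : 3 * ((L : ℝ) - 1) * (r₁ + r₂) ≤ 1) :
    ‖w‖ ≤ 3 * ((L : ℝ) - 1) * (r₁ + r₂) := by
  have hR0 : 0 ≤ 3 * ((L : ℝ) - 1) * (r₁ + r₂) := by
    have h := frobNorm_basedExt_sub_one_le L hU hUh 0
    exact (frobNorm_nonneg _).trans h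
  refine (pi_norm_le_iff_of_nonneg hR0).mpr fun y => ?_
  have h := frobNorm_basedExt_sub_one_le L hU hUh y.1
  rw [basedExt_of_ne L _ y.2] at h
  exact norm_le_of_frobNorm_gnoPoint_le hsmall h

end Summit.QuantumFields.YangMills.Theorems.FemtoTransferGap.TwoLattice.ConstTube

end
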